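import Literature.AlgebraicGeometry.Frobenioids.PadicFrobenioidUnitGroups
import Literature.AlgebraicGeometry.Frobenioids.PadicFieldwiseSaturatedPrelim
import HarnessLib

/-!
# Frobenioids II, Thm. 2.4 (ii), first step: `B(A_D) ⥲ K_A^×` for a FIELDWISE SATURATED `p`-adic Frobenioid
# ("reconstructing the multiplicative group of the field of `Aᵢ`"; sub-DAG W12 row L17 `PairIso`, piece (α1))

Mochizuki, *The geometry of Frobenioids II*, Kyushu J. Math. **62** (2008) 401–460, §2, proof of Theorem
2.4 (ii), p. 20 l.−3 – p. 21 l.6 [cite: MochizukiFrdII2008, Thm 2.4 (ii) p.20], VERBATIM (author's PDF,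
`paper:url-4322d76898e0` p. 20 last 3 lines – p. 21 l. 6, read 2026-08-26): "Then since `Φᵢ` is fieldwise
saturated, it follows — by varying the objects `Aᵢ` [that correspond via `Ψ`] and reconstructing the
multiplicative group associated to the field determined by the image of `Aᵢ` in `B(Gᵢ, Gᵢ°)` as the
groupification of the monoid `O^▷(Aᵢ) = O^□(Aᵢ)` — that `Ψ` induces a pair of compatible isomorphisms
`G₁ ⥲ G₂`; `K̄₁^× ⥲ K̄₂^×` — where this pair is well-defined up to composition with automorphisms of the pair
`(G₂, K̄₂^×)` induced by elements of `G₂`."  And p. 20 (proof of (i)): "`Ψ` induces a 1-compatible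
equivalence of categories `Ψ^Base : D₁ ⥲ D₂`, as well as compatible isomorphisms of functors `Φ₁ ⥲ Φ₂`,
`B₁ ⥲ B₂` — where we regard “`O^▷(−)`” as a subfunctor of `Bᵢ` [such that `Bᵢ` is the groupification of
“`O^▷(−)`”] which is preserved by the isomorphism `B₁ ⥲ B₂`".

PROOF-ONLY file (abc-iut cell, layer L1, `plan/L1/SUBDAG-FrdII-Thm24.md` row **W12-L17 `PairIso`**,
seat abc-iut-w5-d188; census STATUS 2026-08-26T01:06Z, piece (α1)) over abc-iut-L1-t4's datum
`PadicFrd.Datum` (`PadicFrobenioid.lean`: `B = B₀|_D ×_{Φ₀^gp|_D} Φ^gp`, `B₀ = Spec K ↦ K^×`) and the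
arithmetic lemmas of abc-iut-L1-d10 (`PadicFrobenioidDatumLemmas`, `PadicFrobenioidUnitGroups`):

* `Datum.toB0_injective` — for EVERY datum the first projection `B(A) → K_A^×` is injective (the
  square is cartesian and `ι : Φ ↪ Φ₀|_D`, hence `ι^gp`, is injective — `MonGp.map_injective`);
* (`Div₀(x) ∈ ord(K_A^×)` for every `x ∈ K_A^×` is abc-iut-w5-d229's `Datum.divZeroHom_mem_ordUnitsSubgroup`,
  `PadicFieldwiseSaturatedPrelim.lean`, imported);
* `Datum.toB0_surjective_of_isFieldwiseSaturated` — if `Φ` is FIELDWISE SATURATED ("`ord(K^×) ⊆ Φ(K)`",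
  Ex. 1.1 (ii)), then `B(A) → K_A^×` is surjective: every `x ∈ K_A^×` has `Div₀(x) = ι^gp(γ)` for some
  `γ ∈ Φ^gp(A)`, and the cartesian square supplies `b ∈ B(A)` over `(x, γ)`;
* `Datum.toB0_bijective_of_isFieldwiseSaturated` / `exists_mulEquiv_bObj_fldUnits` — hence
  `B(A) ≃* K_A^×`, NATURAL in `A` (`toB0_naturality_apply`: it is the component of the natural
  transformation `B → B₀|_D`).

This is the object-wise half of «`K_Aᵢ^× = O^▷(Aᵢ)^gp`» (the other half, `O^▷(A)^gp = B(A_D)` under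
fieldwise saturation, and the colimit over `A` — "by varying the objects `Aᵢ`" — are pieces (α2)/(β) of the census).
Theorems only (no definitions); nothing here bears on [IUTchIII] Cor. 3.12.
-/

namespace Literature.AlgebraicGeometry.Frobenioids

open CategoryTheory Opposite Function

universe v u

namespace PadicFrd.Datum

variable {D : Type u} [Category.{v} D] {p : ℕ} [Fact p.Prime] (d : Datum D p)

/-- **`B(A) → K_A^×` is injective** for every datum: an element of `B(A) = K_A^× ×_{Φ₀^gp} Φ^gp(A)` is
determined by its two components (`B_ext`), and the `Φ^gp`-component is determined by the
`K^×`-component because `ι^gp : Φ^gp(A) → Φ₀^gp(A)` is injective (`ι` is objectwise injective into the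
cancellative `Φ₀(A) = ord(O_K^⊳) ⊗ ℝ_{≥0}`). [cite: MochizukiFrdII2008, Ex 1.1 (ii) p.8] -/
theorem toB0_injective (A : Dᵒᵖ) : Injective (d.toB0.app A).hom := by
  intro u u' h
  haveI : IsCancelMul ((phiZeroOn d.base).obj A) := isCancelMul_realification (OrdInt (d.fld A.unop))
  have hι : Injective (MonGp.map (d.ι.app A).hom) := MonGp.map_injective _ (d.ι_injective A)
  refine d.B_ext A h (hι ?_)
  rw [← d.square_apply A u, ← d.square_apply A u', h]

/-- The subgroup generated by the image of `Φ(A) → Φ₀^gp(A)` is the image of `ι^gp : Φ^gp(A) → Φ₀^gp(A)`.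
[cite: MochizukiFrdII2008, Ex 1.1 (ii) p.8] -/
theorem closure_range_phiGp_le (A : D) :
    Subgroup.closure (Set.range (d.phiGp A)) ≤ (MonGp.map (d.ι.app (op A)).hom).range := by
  refine (Subgroup.closure_le _).mpr ?_
  rintro _ ⟨y, rfl⟩
  exact ⟨Algebra.GrothendieckGroup.of y, by rw [MonGp.map_of]; rfl⟩

/-- **`B(A) → K_A^×` is surjective for a FIELDWISE SATURATED datum** ("`ord(K^×) ⊆ Φ(K)`", Ex. 1.1
(ii)): for `x ∈ K_A^×`, `Div₀(x) ∈ ord(K_A^×) ⊆ ι^gp(Φ^gp(A))`, say `= ι^gp(γ)`, and the cartesian square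
`B(A) = K_A^× ×_{Φ₀^gp} Φ^gp(A)` contains an element over `(x, γ)`.
[cite: MochizukiFrdII2008, Thm 2.4 (ii) p.20] -/
theorem toB0_surjective_of_isFieldwiseSaturated (hfs : d.IsFieldwiseSaturated) (A : Dᵒᵖ) :
    Surjective (d.toB0.app A).hom := by
  intro x
  have hmem := d.closure_range_phiGp_le A.unop (hfs A.unop (d.divZeroHom_mem_ordUnitsSubgroup A.unop x))
  obtain ⟨γ, hγ⟩ := hmem
  obtain ⟨u, hu, -⟩ := d.exists_B_of_compat A x γ hγ.symm
  exact ⟨u, hu⟩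

/-- **`B(A) ⥲ K_A^×` for a fieldwise saturated `p`-adic Frobenioid**: the first projection
`B(A) → K_A^×` is BIJECTIVE — print's "reconstructing the multiplicative group associated to the field
determined by the image of `Aᵢ` … as the groupification of the monoid `O^▷(Aᵢ)`" (p. 20 l.−2 – p. 21 l. 2) at the level
of `B(A) (= O^▷(A)^gp)` (FrdII p. 20 l.−3). [cite: MochizukiFrdII2008, Thm 2.4 (ii) p.20] -/
theorem toB0_bijective_of_isFieldwiseSaturated (hfs : d.IsFieldwiseSaturated) (A : Dᵒᵖ) :
    Bijective (d.toB0.app A).hom :=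
  ⟨d.toB0_injective A, d.toB0_surjective_of_isFieldwiseSaturated hfs A⟩

/-- Hence a multiplicative equivalence `B(A) ≃* K_A^×` whose underlying map is the component of the natural
transformation `B → B₀|_D` (so the equivalences for varying `A` are compatible with the transition maps
`B(f)`, `K_A^× → K_{A'}^×` — "by varying the objects `Aᵢ`", p. 20 l.−2). Existence form (proof-only file).
[cite: MochizukiFrdII2008, Thm 2.4 (ii) p.20] -/
theorem exists_mulEquiv_bObj_fldUnits (hfs : d.IsFieldwiseSaturated) (A : Dᵒᵖ) :
    ∃ e : d.B.obj A ≃* (d.fld A.unop)ˣ, ∀ b, e b = (d.toB0.app A).hom b :=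
  ⟨MulEquiv.ofBijective (d.toB0.app A).hom (d.toB0_bijective_of_isFieldwiseSaturated hfs A), fun _ => rfl⟩

/-- **Naturality** of the reconstruction ("by varying the objects `Aᵢ`", p. 20 l.−2): for `f : A → A'` in `Dᵒᵖ` (a morphism
`A' → A` of `D`, i.e. a valuative field embedding `K_A → K_{A'}`), the projections commute with `B(f)` and
`B₀(f) = (K_A^× → K_{A'}^×)` — the naturality square of `B → B₀|_D`, evaluated.
[cite: MochizukiFrdII2008, Thm 2.4 (ii) p.20] -/
theorem toB0_naturality_apply {A A' : Dᵒᵖ} (f : A ⟶ A') (b : d.B.obj A) :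
    (d.toB0.app A').hom ((d.B.map f).hom b) = ((bZeroOn d.base).map f).hom ((d.toB0.app A).hom b) :=
  congrArg (fun g : d.B.obj A ⟶ (bZeroOn d.base).obj A' => g.hom b) (d.toB0.naturality f)

end PadicFrd.Datum

end Literature.AlgebraicGeometry.Frobenioids
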